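import Literature.AlgebraicGeometry.Deformation.SmallExtensionFactorization
import Literature.AlgebraicGeometry.Deformation.T1LiftingAuxiliaryAlgebras
import HarnessLib

/-!
# (H₂) does not depend on the model of `k[ε] → k`: `ArtAlg.sqZeroExt k → ArtAlg.base k` versus `B_0 → A_0`

Family `hodge` (computation cell `pub-hsemireg`, LIT-W seat «Pridham / derived deformation theory as printed»), layer
`Literature/AlgebraicGeometry/Deformation`. [Schlessinger1968, Thm. 2.11, p. 212] states (H₂) as «(2.12) is a
bijection when `A = k`, `A'' = k[ε]`» for THE dual numbers `k[ε] → k`. The tree carries two models of this arrow of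
`Art_k`:
* `ArtAlg.sqZeroExtAug k : ArtAlg.sqZeroExt k → ArtAlg.base k` (`SmallExtensionFactorization.lean` §6–§8: Mathlib's
  `TrivSqZeroExt k k = DualNumber k → k`), along which the hull road (`HullExistence`, `HullRingForm`, …) assumes
  `F.IsBijectiveAlong (ArtAlg.sqZeroExtAug k)`;
* `T1Lifting.bA k 0 : B k 0 → A k 0` (`T1Lifting.lean` / `T1LiftingAuxiliaryAlgebras.lean`:
  `B_0 = (k[t]/(t))[ε] → A_0 = k[t]/(t)`), along which [FantechiManetti1999T1Lifting]'s Theorem A′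
  (`ArtinFunctor.t1Lifting_theorem`) assumes the square-form `ArtinFunctor.H2`.
`SmallExtensionFactorization.lean` (module docstring, «Not here») leaves «the identification of
`T1LiftingAuxiliaryAlgebras`'s model `B k 0 → A k 0` of `k[ε] → k` with `ArtAlg.sqZeroExt k → ArtAlg.base k` (an
instance of `ArtinFunctor.IsBijectiveAlong.of_algEquiv`)» «to the file that imports both» — this file:
`T1Lifting.baseEquivA0 : k ≃ₐ[k] A k 0`, `T1Lifting.dualNumberEquivB0 : DualNumber k ≃ₐ[k] B k 0` intertwining the
two arrows (`bA_zero_comp_dualNumberEquivB0`), and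
**`ArtinFunctor.H2_iff_isBijectiveAlong_sqZeroExtAug : F.H2 ↔ F.IsBijectiveAlong (ArtAlg.sqZeroExtAug k)`**.
Definitions with body and theorems; no named fact, no `sorry`.

## References
* [Schlessinger1968] M. Schlessinger, Functors of Artin rings, Trans. AMS 130 (1968): Thm. 2.11 (H₂) and (2.12), p. 212.
* [FantechiManetti1999T1Lifting] B. Fantechi, M. Manetti, On the T¹-lifting theorem, J. Algebraic Geom. 8 (1999):
  Def. 1.1 (`A_n`, `B_n`), p. 2.
-/

namespace Literature.AlgebraicGeometry.Deformation

universe u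

noncomputable section

variable {k : Type u} [Field k]

namespace T1Lifting

open TrivSqZeroExt

variable (k)

/-- `augA ∘ algebraMap = id` on `k`. [cite: FantechiManetti1999T1Lifting, Def. 1.1] -/
theorem augA_algebraMap (n : ℕ) (c : k) : augA k n (algebraMap k (A k n) c) = c := by
  rw [AlgHom.commutes, Algebra.algebraMap_self, RingHom.id_apply]

/-- **The model `A_0 = k[t]/(t)` of `k`**: the structure map `k → A_0` is an isomorphism of `k`-algebras (inverse
`augA`). [cite: FantechiManetti1999T1Lifting, Def. 1.1] [cite: Schlessinger1968, §1 p. 208 («`k` … residue field»)] -/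
def baseEquivA0 : k ≃ₐ[k] A k 0 :=
  AlgEquiv.ofAlgHom (Algebra.ofId k (A k 0)) (augA k 0)
    (AlgHom.ext fun a => (eq_algebraMap_augA_zero k a).symm)
    (AlgHom.ext fun c => augA_algebraMap k 0 c)

/-- `baseEquivA0 c = c · 1`. [cite: FantechiManetti1999T1Lifting, Def. 1.1] -/
theorem baseEquivA0_apply (c : k) : baseEquivA0 k c = algebraMap k (A k 0) c := rfl

/-- `baseEquivA0⁻¹ = augA`. [cite: FantechiManetti1999T1Lifting, Def. 1.1] -/
theorem baseEquivA0_symm_apply (a : A k 0) : (baseEquivA0 k).symm a = augA k 0 a := rfl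

/-- The `k`-linear equivalence `k[ε] = k ⊕ kε ≃ A_0 ⊕ A_0 ε = B_0` underlying `dualNumberEquivB0`: `baseEquivA0` on both
components. [cite: FantechiManetti1999T1Lifting, Def. 1.1] -/
def dualNumberLinearEquivB0 : DualNumber k ≃ₗ[k] B k 0 where
  toFun x := ((baseEquivA0 k x.fst, baseEquivA0 k x.snd) : TrivSqZeroExt (A k 0) (A k 0))
  invFun z := (((baseEquivA0 k).symm z.fst, (baseEquivA0 k).symm z.snd) : TrivSqZeroExt k k)
  map_add' x y := TrivSqZeroExt.ext (by simp) (by simp)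
  map_smul' c x := TrivSqZeroExt.ext
    (by simp; simp only [Algebra.smul_def, baseEquivA0_apply])
    (by simp; simp only [Algebra.smul_def, baseEquivA0_apply])
  left_inv x := TrivSqZeroExt.ext ((baseEquivA0 k).symm_apply_apply x.fst) ((baseEquivA0 k).symm_apply_apply x.snd)
  right_inv z := TrivSqZeroExt.ext ((baseEquivA0 k).apply_symm_apply z.fst) ((baseEquivA0 k).apply_symm_apply z.snd)

/-- Components of `dualNumberLinearEquivB0`. [cite: FantechiManetti1999T1Lifting, Def. 1.1] -/
@[simp] theorem fst_dualNumberLinearEquivB0 (x : DualNumber k) :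
    (dualNumberLinearEquivB0 k x).fst = baseEquivA0 k x.fst := rfl

/-- Components of `dualNumberLinearEquivB0`. [cite: FantechiManetti1999T1Lifting, Def. 1.1] -/
@[simp] theorem snd_dualNumberLinearEquivB0 (x : DualNumber k) :
    (dualNumberLinearEquivB0 k x).snd = baseEquivA0 k x.snd := rfl

/-- **The model `B_0 = (k[t]/(t))[ε]` of the dual numbers `k[ε]`**: `k[ε] ≃ₐ[k] B_0`, `a + bε ↦ a + bε` through
`k ≅ A_0`. [cite: FantechiManetti1999T1Lifting, Def. 1.1] [cite: Schlessinger1968, Thm. 2.11 (H₂), p. 212] -/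
def dualNumberEquivB0 : DualNumber k ≃ₐ[k] B k 0 :=
  AlgEquiv.ofLinearEquiv (dualNumberLinearEquivB0 k)
    (TrivSqZeroExt.ext (by simp) (by simp))
    (fun x y => TrivSqZeroExt.ext (by simp) (by
      simp only [snd_dualNumberLinearEquivB0, snd_mul, fst_dualNumberLinearEquivB0, smul_eq_mul,
        MulOpposite.smul_eq_mul_unop, MulOpposite.unop_op, map_add, map_mul]))

/-- `dualNumberEquivB0` on elements. [cite: FantechiManetti1999T1Lifting, Def. 1.1] -/
@[simp] theorem fst_dualNumberEquivB0 (x : DualNumber k) :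
    (dualNumberEquivB0 k x).fst = algebraMap k (A k 0) x.fst := rfl

/-- `dualNumberEquivB0` on elements. [cite: FantechiManetti1999T1Lifting, Def. 1.1] -/
@[simp] theorem snd_dualNumberEquivB0 (x : DualNumber k) :
    (dualNumberEquivB0 k x).snd = algebraMap k (A k 0) x.snd := rfl

/-- `dualNumberEquivB0 ε = ε`. [cite: FantechiManetti1999T1Lifting, Def. 1.1] -/
theorem dualNumberEquivB0_eps : dualNumberEquivB0 k DualNumber.eps = DualNumber.eps :=
  TrivSqZeroExt.ext (by simp) (by simp)

/-- **The two models of `k[ε] → k` are intertwined**: `bA_0 ∘ (k[ε] ≅ B_0) = (k ≅ A_0) ∘ (k[ε] → k)` (first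
projections on both sides). [cite: FantechiManetti1999T1Lifting, Def. 1.1 («`B_n → A_n` … `x ↦ t, y ↦ 0`»)]
[cite: Schlessinger1968, Thm. 2.11 (H₂), p. 212] -/
theorem bA_zero_comp_dualNumberEquivB0 :
    (bA k 0).comp (dualNumberEquivB0 k : DualNumber k →ₐ[k] B k 0) =
      (baseEquivA0 k : k →ₐ[k] A k 0).comp (TrivSqZeroExt.fstHom k k k) :=
  AlgHom.ext fun _ => rfl

end T1Lifting

open T1Lifting

/-- **(H₂) along `k[ε] → k` (SEF model) ⇒ (H₂) in the square form of `T1LiftingAuxiliaryAlgebras` (model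
`B_0 → A_0`)** — `ArtinFunctor.IsBijectiveAlong.of_algEquiv` along `dualNumberEquivB0`, `baseEquivA0`.
[cite: Schlessinger1968, Thm. 2.11 (H₂) and (2.12), p. 212] -/
theorem ArtinFunctor.H2_of_isBijectiveAlong_sqZeroExtAug (F : ArtinFunctor.{u} k)
    (h2 : F.IsBijectiveAlong (R₀ := ArtAlg.base k) (R₁ := ArtAlg.sqZeroExt (k := k) k) (ArtAlg.sqZeroExtAug k)) :
    F.H2 :=
  fun _ _ q q' p' hc =>
    (h2.of_algEquiv (R₀' := artA k 0) (R₁' := artB k 0) (p₁ := bA k 0) (dualNumberEquivB0 k) (baseEquivA0 k)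
      (bA_zero_comp_dualNumberEquivB0 k)) q q' p' hc

/-- **(H₂) in square form (model `B_0 → A_0`) ⇒ (H₂) along `k[ε] → k` (SEF model)** — transport back along the
inverse isomorphisms. [cite: Schlessinger1968, Thm. 2.11 (H₂) and (2.12), p. 212] -/
theorem ArtinFunctor.isBijectiveAlong_sqZeroExtAug_of_H2 (F : ArtinFunctor.{u} k) (h2 : F.H2) :
    F.IsBijectiveAlong (R₀ := ArtAlg.base k) (R₁ := ArtAlg.sqZeroExt (k := k) k) (ArtAlg.sqZeroExtAug k) := by
  have h : F.IsBijectiveAlong (R₀ := artA k 0) (R₁ := artB k 0) (bA k 0) := fun _ _ q q' p' hc => h2 q q' p' hc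
  refine h.of_algEquiv (R₀' := ArtAlg.base k) (R₁' := ArtAlg.sqZeroExt (k := k) k) (p₁ := ArtAlg.sqZeroExtAug k)
    (dualNumberEquivB0 k).symm (baseEquivA0 k).symm (AlgHom.ext fun z => ?_)
  -- `fst (e₁⁻¹ z) = augA (fst z) = e₀⁻¹ (bA z)`
  rfl

/-- **(H₂) is model-independent**: the square-form `ArtinFunctor.H2` of `T1LiftingAuxiliaryAlgebras` (fibre products
over `B_0 → A_0`) ⇔ «(2.12) is a bijection» along `ArtAlg.sqZeroExt k → ArtAlg.base k` (`SmallExtensionFactorization`).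
[cite: Schlessinger1968, Thm. 2.11 (H₂) and (2.12), p. 212] -/
theorem ArtinFunctor.H2_iff_isBijectiveAlong_sqZeroExtAug (F : ArtinFunctor.{u} k) :
    F.H2 ↔ F.IsBijectiveAlong (R₀ := ArtAlg.base k) (R₁ := ArtAlg.sqZeroExt (k := k) k) (ArtAlg.sqZeroExtAug k) :=
  ⟨F.isBijectiveAlong_sqZeroExtAug_of_H2, F.H2_of_isBijectiveAlong_sqZeroExtAug⟩

end

end Literature.AlgebraicGeometry.Deformation
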